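import Summits.BirchSwinnertonDyer.BirchSwinnertonDyer.Theorems.GenusKolyvaginAtTwoEquivariantKolyvaginExactAtTwoTwinGrossPrimes
import HarnessLib

/-!
# Route `ByReductionTypeAtTwo`, crux `RankOneAtTwoOffBigImageOddLocal` (stmt-BirchSwinnertonDyer-23716), line
# `refined_kolyvagin_tamagawa_shift_at_two`, stub `stub_sigmaShiftPosDisc`: a **REGULAR** Kolyvagin prime of `E` is one of EVERY quadratic twist
# `E^{(d)}` (any model, any `d ≠ 0`) — the regular analogue of the sibling's `TwinGrossPrimes` transfer, with NO parity condition on `√d`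

Lead prover `prover-cruxlead-stmt-BirchSwinnertonDyer-23716-g4` (2026-08-28; `--supports` the crux, closes nothing).  Sixth regular-engine CONSUMER.
The sibling route's pair descent over `ℚ` (seat `bsd-line-gk2-p3`) runs the local theory at a Kolyvagin prime for BOTH members of the pair
`(E, E^{(d_K)})`; `…TwinGrossPrimes.frobEqFrobInfty_of_smul_quadraticTwist_eq` moves the Gross–Kolyvagin condition `Frob(ℓ) = Frob(∞)` from `E` to the
twin, using that the witnessing Frobenius and complex conjugation both negate `√d_K`.  For the REGULAR datum of this line's engine («some arithmetic
Frobenius at some `𝔓 ∣ ℓ` acts on `E[q]` as an involution MOVING a `2`-torsion point») the transfer is UNCONDITIONAL in `d` and in the sign of `h` on `√d`: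
along the signed isomorphism `f : E′(ℚ̄) ≃+ E(ℚ̄)`, `f(h·P) = ±h·f(P)` (tree `exists_addEquiv_geomPoints_sign_of_smul_quadraticTwist_eq`,
`smul_geomSqrt_eq_or`), and `±h` is again an involution with the same fixed `2`-torsion (`−u = u` on `E[2]`).

* `regularInvolution_of_smul_quadraticTwist_eq` — the torsion-level statement (any base field `F` with `2 ≠ 0`);
* `regularFrobDatum_of_smul_quadraticTwist_eq` — the engine's datum `∃ 𝔓 h, 𝔓 ∣ v ∧ Frob ∧ involution on E[q] ∧ moves E[2]` for `E` ⟹ the same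
  datum (same `𝔓`, same `h`) for every model `E′` of every twist `E^{(d)}`, `d ≠ 0` — in particular for the twin `E^K` of the pair descent, feeding
  `…EngineRegularPropFourFourRat.zsmul_mem_selmerLocalKer_iff_zsmul_twist_mem_torsionLocalKer_of_K_regular` (`hreg'`) and the `_regular` local
  structure files for the twin.

THEOREMS ONLY (no definition, no named fact, no `sorry`, standard axioms).  BSD is not proved by any of this; the crux is not proved; the stub is not proved.

References: [SilvermanAEC2009] X.2 Prop. 2.4, X.5 Cor. 5.4; [GrossLMS1991] §3 (3.2); [McCallumLMS1991] §5.
-/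

set_option autoImplicit false
set_option linter.dupNamespace false -- tree convention: `Summit.BirchSwinnertonDyer.BirchSwinnertonDyer.Theorems` (summit = sub-problem)

noncomputable section

open scoped Classical

namespace Summit.BirchSwinnertonDyer.BirchSwinnertonDyer.Theorems.OffBigImageOddLocalAtTwo.Engine

open WeierstrassCurve NumberField IsDedekindDomain Field
open Literature.NumberTheory.EllipticCurves Literature.NumberTheory.GaloisRepresentations
open Literature.NumberTheory.EllipticCurves.Rank1Residual
open Summit.BirchSwinnertonDyer.BirchSwinnertonDyer.Theorems.GenusExact.TwinGrossPrimes

universe u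

/-! ## §1 Torsion level: a regular involution of `E` is a regular involution of every twist -/

section Signed

variable {F : Type u} [Field F] [NeZero (2 : F)]

/-- **Transport of «involution on the `n`-torsion moving a `2`-torsion point» along the signed twist isomorphism.**  For any model `W′` of
`W^{(d)}` (`C • W.quadraticTwist d = W′`, `d ≠ 0`) and any `h ∈ Γ_F`: if `h` acts on `E[n]` as an involution and moves some point of `E[2]`, then it
acts on `E′[n]` as an involution and moves some point of `E′[2]`.  Proof: `f(h·P) = ε·h·f(P)` with `ε = ±1` the sign of `h` on `√d`
(`smul_geomSqrt_eq_or`); `ε² = 1` gives the involution, and on `2`-torsion `ε = 1`. [cite: SilvermanAEC2009, X.5 Cor. 5.4 and X.2 Prop. 2.4] -/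
theorem regularInvolution_of_smul_quadraticTwist_eq (W W' : WeierstrassCurve F) {d : F} (hd : d ≠ 0)
    {C : VariableChange F} (hC : C • W.quadraticTwist d = W') (h : absoluteGaloisGroup F) {n : ℤ}
    (hinv : ∀ X : W.geomTorsion n, h • h • X = X) (hmv : ∃ u : W.geomTorsion 2, h • u ≠ u) :
    (∀ X : W'.geomTorsion n, h • h • X = X) ∧ ∃ u : W'.geomTorsion 2, h • u ≠ u := by
  obtain ⟨f, hfpos, hfneg⟩ := exists_addEquiv_geomPoints_sign_of_smul_quadraticTwist_eq W W' hd hC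
  -- `f (h • P) = ε (h • f P)` with `ε ∈ {id, neg}`; in both cases `f (h • h • P) = h • h • f P`
  have hff : ∀ P : W'.geomPoints, f (h • h • P) = h • h • f P := fun P ↦ by
    rcases smul_geomSqrt_eq_or h d with hs | hs
    · rw [hfpos h hs, hfpos h hs]
    · rw [hfneg h hs, hfneg h hs, smul_neg, neg_neg]
  refine ⟨fun X ↦ ?_, ?_⟩
  · apply Subtype.ext
    apply f.injective
    rw [AddSubgroup.torsionBy.coe_smul, AddSubgroup.torsionBy.coe_smul, hff]
    have hmem : f (X : W'.geomPoints) ∈ W.geomTorsion n := map_mem_geomTorsion f X.2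
    have key := congrArg (fun Q : W.geomTorsion n ↦ (Q : W.geomPoints)) (hinv ⟨f X, hmem⟩)
    simpa only [AddSubgroup.torsionBy.coe_smul] using key
  · obtain ⟨u, hu⟩ := hmv
    have hmem : f.symm (u : W.geomPoints) ∈ W'.geomTorsion 2 := map_mem_geomTorsion f.symm u.2
    refine ⟨⟨f.symm u, hmem⟩, fun heq ↦ hu ?_⟩
    have key := congrArg (fun Q : W'.geomTorsion 2 ↦ f (Q : W'.geomPoints)) heq
    simp only [AddSubgroup.torsionBy.coe_smul, AddEquiv.apply_symm_apply] at key
    -- `key : f (h • f.symm u) = u`; `f (h • f.symm u) = ± h • u`, and `-(h • u) = h • u` on `2`-torsion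
    have h2 : (2 : ℤ) • (h • (u : W.geomPoints)) = 0 := by
      rw [← AddSubgroup.torsionBy.coe_smul]
      exact (mem_geomTorsion_iff W 2 _).mp (h • u).2
    have hneg2 : -(h • (u : W.geomPoints)) = h • (u : W.geomPoints) := by
      rw [neg_eq_iff_add_eq_zero, ← two_zsmul]; exact h2
    apply Subtype.ext
    rw [AddSubgroup.torsionBy.coe_smul]
    rcases smul_geomSqrt_eq_or h d with hs | hs
    · rw [hfpos h hs, AddEquiv.apply_symm_apply] at key
      exact key
    · rw [hfneg h hs, AddEquiv.apply_symm_apply, hneg2] at key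
      exact key

end Signed

/-! ## §2 The engine's regular datum transfers to every twist -/

/-- **A regular Kolyvagin prime of `E` is a regular Kolyvagin prime of every model of every quadratic twist `E^{(d)}`** (same place, same prime
`𝔓 ∣ ℓ`, same Frobenius): the engine's datum for `W` at level `q` ⟹ the datum for `W′` whenever `C • W.quadraticTwist d = W′`, `d ≠ 0`.  In the
pair descent this feeds the twin side (`W′` a model of `E^{(d_K)}`) of `…EngineRegularPropFourFourRat`, `…EngineRegularLocalStructure`,
`…EngineRegularKolyvaginPrimeDictionary`. [cite: SilvermanAEC2009, X.5 Cor. 5.4] [cite: GrossLMS1991, §3 (3.2)] -/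
theorem regularFrobDatum_of_smul_quadraticTwist_eq (W W' : WeierstrassCurve ℚ) {d : ℚ} (hd : d ≠ 0)
    {C : VariableChange ℚ} (hC : C • W.quadraticTwist d = W') {v : HeightOneSpectrum (𝓞 ℚ)} {q : ℕ}
    (hreg : ∃ (𝔓 : Ideal (absIntegers (𝓞 ℚ) ℚ)) (h : absoluteGaloisGroup ℚ), 𝔓 ∈ v.primesAbove ∧
      IsArithFrobAt (𝓞 ℚ) h 𝔓 ∧ (∀ X : W.geomTorsion (q : ℤ), h • h • X = X) ∧ ∃ u : W.geomTorsion 2, h • u ≠ u) :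
    ∃ (𝔓 : Ideal (absIntegers (𝓞 ℚ) ℚ)) (h : absoluteGaloisGroup ℚ), 𝔓 ∈ v.primesAbove ∧
      IsArithFrobAt (𝓞 ℚ) h 𝔓 ∧ (∀ X : W'.geomTorsion (q : ℤ), h • h • X = X) ∧ ∃ u : W'.geomTorsion 2, h • u ≠ u := by
  obtain ⟨𝔓, h, h𝔓, hFrob, hinv, hmv⟩ := hreg
  obtain ⟨hinv', hmv'⟩ := regularInvolution_of_smul_quadraticTwist_eq W W' hd hC h hinv hmv
  exact ⟨𝔓, h, h𝔓, hFrob, hinv', hmv'⟩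

/-- The level-`2` form of the transfer (the shape `…EngineRegularReductionCyclic` / `…EngineRegularLocalStructure` take: involution on
`E[2] = geomTorsion W ((2 : ℕ) : ℤ)` moving a point there). [cite: SilvermanAEC2009, X.5 Cor. 5.4] -/
theorem regularFrobDatum_two_of_smul_quadraticTwist_eq (W W' : WeierstrassCurve ℚ) {d : ℚ} (hd : d ≠ 0)
    {C : VariableChange ℚ} (hC : C • W.quadraticTwist d = W') {v : HeightOneSpectrum (𝓞 ℚ)}
    (hreg : ∃ (𝔓 : Ideal (absIntegers (𝓞 ℚ) ℚ)) (h : absoluteGaloisGroup ℚ), 𝔓 ∈ v.primesAbove ∧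
      IsArithFrobAt (𝓞 ℚ) h 𝔓 ∧ (∀ P : W.geomTorsion ((2 : ℕ) : ℤ), h • h • P = P) ∧
      ∃ u : W.geomTorsion ((2 : ℕ) : ℤ), h • u ≠ u) :
    ∃ (𝔓 : Ideal (absIntegers (𝓞 ℚ) ℚ)) (h : absoluteGaloisGroup ℚ), 𝔓 ∈ v.primesAbove ∧
      IsArithFrobAt (𝓞 ℚ) h 𝔓 ∧ (∀ P : W'.geomTorsion ((2 : ℕ) : ℤ), h • h • P = P) ∧
      ∃ u : W'.geomTorsion ((2 : ℕ) : ℤ), h • u ≠ u := by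
  obtain ⟨𝔓, h, h𝔓, hFrob, hinv, hmv⟩ := hreg
  have hinv2 : ∀ X : W.geomTorsion (((2 : ℕ) : ℕ) : ℤ), h • h • X = X := hinv
  obtain ⟨u, hu⟩ := hmv
  have hmv2 : ∃ u : W.geomTorsion 2, h • u ≠ u := by
    refine ⟨⟨u.1, by simp⟩, fun heq ↦ hu (Subtype.ext ?_)⟩
    exact congrArg Subtype.val heq
  obtain ⟨hinv', hmv'⟩ := regularInvolution_of_smul_quadraticTwist_eq W W' hd hC h hinv2 hmv2
  obtain ⟨u', hu'⟩ := hmv'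
  refine ⟨𝔓, h, h𝔓, hFrob, hinv', ⟨⟨u'.1, by simp⟩, fun heq ↦ hu' (Subtype.ext ?_)⟩⟩
  exact congrArg Subtype.val heq

end Summit.BirchSwinnertonDyer.BirchSwinnertonDyer.Theorems.OffBigImageOddLocalAtTwo.Engine

end
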